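import Literature.AlgebraicGeometry.Resolution.FiniteBirationalNormal
import Summits.ResolutionOfSingularities.ResolutionOfSingularities.Theorems.PAlterationAssemblyExponent
import Mathlib.AlgebraicGeometry.Morphisms.UniversallyInjective
import Mathlib.AlgebraicGeometry.Morphisms.Finite
import Mathlib.Algebra.CharP.Basic
import HarnessLib

/-!
# `PAlteration.Assembly` (stmt-ResolutionOfSingularities-0553): sections of a finite radicial morphism onto a normal scheme

Route `ResolutionOfSingularities/pAlteration`, item `Assembly` (stmt-0553); helper file
(`--supports`). Scheme-level wrapper of `exists_frobeniusFactor`: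

* `exists_mul_pow_eq_of_universallyInjective` — for a dominant, universally injective morphism
  `f : X → Y` of integral schemes of characteristic `p` and an affine open `V ⊆ Y`, every
  section `c ∈ Γ(X, f⁻¹V)` satisfies `f^*(s) · c^{p^n} = f^*(a)` for some `n` and
  `a, s ∈ Γ(Y, V)`, `s ≠ 0` (the residue field extension at the generic point is purely
  inseparable, and `K(Y) = Frac Γ(Y, V)`);
* `exists_frobeniusFactor_app` — if moreover `f` is finite and `Y` is normal, then for some `N`
  the `p^N`-th power map of `Γ(X, f⁻¹V)` factors through `Γ(Y, V)`:
  `σ : Γ(X, f⁻¹V) → Γ(Y, V)` with `f^* ∘ σ = Frob^N`, `σ ∘ f^* = Frob^N`.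
-/

-- single-problem summit: the doubled namespace component `ResolutionOfSingularities` is forced
set_option linter.dupNamespace false

noncomputable section

open CategoryTheory CategoryTheory.Limits AlgebraicGeometry TopologicalSpace Topology

open Literature.AlgebraicGeometry.Resolution

namespace Summit.ResolutionOfSingularities.ResolutionOfSingularities.Theorems

universe u

variable {X Y : Scheme.{u}} [IsIntegral X] [IsIntegral Y] (f : X ⟶ Y)

/-- For a dominant morphism of integral schemes, the pull-back of functions
`K(Y) = 𝒪_{Y,η_Y} → 𝒪_{X,η_X} = K(X)` (stalk map at the generic point, transported along
`f η_X = η_Y`) is compatible with `f^*` on sections: for `a ∈ Γ(Y, V)` the germ of `f^* a` at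
`η_X` is the image of the germ of `a` at `η_Y`. [folklore] -/
theorem exists_functionField_hom [IsDominant f] (V : Y.Opens) [Nonempty (f ⁻¹ᵁ V)]
    [Nonempty V] :
    ∃ e : Y.functionField →+* X.functionField,
      (∀ a : Γ(Y, V), e (Y.germToFunctionField V a) =
        X.germToFunctionField (f ⁻¹ᵁ V) (f.app V a)) ∧
      ∀ t : Y.presheaf.stalk (f.base (genericPoint X)),
        e ((Y.presheaf.stalkCongr (.of_eq (genericPoint_eq_of_isDominant f))).hom t) =
          f.stalkMap (genericPoint X) t := by
  have hfη : f.base (genericPoint X) = genericPoint Y := genericPoint_eq_of_isDominant f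
  have hηV : genericPoint Y ∈ V :=
    ((genericPoint_spec Y).mem_open_set_iff V.isOpen).mpr (by simpa using ‹Nonempty V›)
  have hξV : genericPoint X ∈ f ⁻¹ᵁ V :=
    ((genericPoint_spec X).mem_open_set_iff (f ⁻¹ᵁ V).isOpen).mpr
      (by simpa using ‹Nonempty (f ⁻¹ᵁ V)›)
  let e0 : Y.presheaf.stalk (genericPoint Y) ⟶ X.functionField :=
    (Y.presheaf.stalkCongr (.of_eq hfη.symm)).hom ≫ f.stalkMap (genericPoint X)
  have hsp : f.base (genericPoint X) ⤳ genericPoint Y := by rw [hfη]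
  refine ⟨e0.hom, fun a => ?_, fun t => ?_⟩
  · show (Y.presheaf.germ V (genericPoint Y) hηV ≫
      Y.presheaf.stalkSpecializes hsp ≫ f.stalkMap (genericPoint X)) a =
        (f.app V ≫ X.presheaf.germ (f ⁻¹ᵁ V) (genericPoint X) hξV) a
    rw [TopCat.Presheaf.germ_stalkSpecializes_assoc, Scheme.Hom.germ_stalkMap]
  · show ((Y.presheaf.stalkCongr (.of_eq hfη)).hom ≫
      (Y.presheaf.stalkCongr (.of_eq hfη.symm)).hom ≫ f.stalkMap (genericPoint X)) t = _
    rw [← Category.assoc]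
    have hid : (Y.presheaf.stalkCongr (.of_eq hfη)).hom ≫
        (Y.presheaf.stalkCongr (.of_eq hfη.symm)).hom = 𝟙 _ := by
      simp [TopCat.Presheaf.stalkCongr_hom]
    rw [hid, Category.id_comp]

/-- The stalk of an integral scheme at a point which is (equal to) the generic point is a field.
[folklore] -/
theorem isField_stalk_of_eq_genericPoint {y : Y} (hy : y = genericPoint Y) :
    IsField (Y.presheaf.stalk y) := by
  subst hy
  exact (inferInstance : Field Y.functionField).toIsField

omit [IsIntegral X] [IsIntegral Y] in
/-- In a local ring which is a field the residue map is injective. [folklore] -/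
theorem residue_injective_of_isField {R : Type*} [CommRing R] [IsLocalRing R] (hR : IsField R) :
    Function.Injective (IsLocalRing.residue R) := by
  intro a b hab
  rw [← sub_eq_zero, ← map_sub, IsLocalRing.residue_eq_zero_iff] at hab
  letI := hR.toField
  have hmax : IsLocalRing.maximalIdeal R = ⊥ :=
    (IsLocalRing.maximalIdeal R).eq_bot_of_prime
  rw [hmax, Ideal.mem_bot, sub_eq_zero] at hab
  exact hab

/-- **Radicial relations for sections of a universally injective dominant morphism.** Let
`f : X → Y` be a dominant, universally injective morphism of integral schemes, `p` a prime with
`p = 0` on `Y`, and `V ⊆ Y` an affine open. Then every `c ∈ Γ(X, f⁻¹V)` satisfies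
`f^*(s) · c^{p^n} = f^*(a)` for some `n` and `a, s ∈ Γ(Y, V)` with `s ≠ 0`: the residue field
extension `κ(η_Y) ⊆ κ(η_X)` is purely inseparable (Stacks 01S4) and `κ(η_Y) = Frac Γ(Y, V)`.
[folklore] -/
theorem exists_mul_pow_eq_of_universallyInjective [IsDominant f] [UniversallyInjective f]
    (p : ℕ) [Fact p.Prime] (hp : (p : Γ(Y, ⊤)) = 0) (V : Y.Opens) (hV : IsAffineOpen V)
    [Nonempty (f ⁻¹ᵁ V)] [Nonempty V] (c : Γ(X, f ⁻¹ᵁ V)) :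
    ∃ (n : ℕ) (a s : Γ(Y, V)), s ≠ 0 ∧ f.app V s * c ^ p ^ n = f.app V a := by
  have hfη : f.base (genericPoint X) = genericPoint Y := genericPoint_eq_of_isDominant f
  obtain ⟨e, he, he'⟩ := exists_functionField_hom f V
  -- the residue field extension at the generic point is purely inseparable
  set ξ := genericPoint X with hξdef
  have h3 : Function.Injective f ∧ ∀ x, (f.residueFieldMap x).hom.IsPurelyInseparable :=
    ((tfae_universallyInjective f).out 0 2).mp ‹UniversallyInjective f›
  have hpi : (f.residueFieldMap ξ).hom.IsPurelyInseparable := h3.2 ξ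
  letI algκ : Algebra (Y.residueField (f.base ξ)) (X.residueField ξ) :=
    (f.residueFieldMap ξ).hom.toAlgebra
  haveI : IsPurelyInseparable (Y.residueField (f.base ξ)) (X.residueField ξ) := hpi
  -- characteristic `p` on the residue fields
  have hpκX : (p : X.residueField ξ) = 0 := by
    rw [← map_natCast (X.Γevaluation ξ).hom p, ← map_natCast f.appTop.hom p, hp, map_zero,
      map_zero]
  have hpκY : (p : Y.residueField (f.base ξ)) = 0 := by
    apply (algebraMap (Y.residueField (f.base ξ)) (X.residueField ξ)).injective
    rw [map_natCast, map_zero, hpκX]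
  haveI : CharP (Y.residueField (f.base ξ)) p :=
    (CharP.charP_iff_prime_eq_zero Fact.out).mpr hpκY
  -- the stalks at the generic points are fields, so the residue maps are injective
  have hFX : IsField (X.presheaf.stalk ξ) := isField_stalk_of_eq_genericPoint rfl
  have hinjX := residue_injective_of_isField hFX
  -- purely inseparable: some `p^n`-th power of the residue of the germ of `c` comes from `κ(f ξ)`
  obtain ⟨n, k, hk⟩ := IsPurelyInseparable.pow_mem (Y.residueField (f.base ξ)) p
    (X.residue ξ (X.germToFunctionField (f ⁻¹ᵁ V) c))
  -- write `k = residue t`, `t` a germ quotient `a / s`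
  obtain ⟨t, rfl⟩ := Ideal.Quotient.mk_surjective k
  change (f.residueFieldMap ξ) (Y.residue (f.base ξ) t) = _ at hk
  rw [← CommRingCat.comp_apply, Scheme.residue_residueFieldMap, CommRingCat.comp_apply,
    ← map_pow] at hk
  replace hk := hinjX hk
  -- `t` transported to `K(Y) = Frac Γ(Y, V)`
  haveI : IsFractionRing Γ(Y, V) Y.functionField :=
    functionField_isFractionRing_of_isAffineOpen Y V hV
  set t' : Y.functionField := (Y.presheaf.stalkCongr (.of_eq hfη)).hom t with ht'
  obtain ⟨⟨a, s⟩, hst⟩ := IsLocalization.mk'_surjective (nonZeroDivisors Γ(Y, V)) t'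
  dsimp only at hst
  refine ⟨n, a, s, nonZeroDivisors.ne_zero s.2, ?_⟩
  have hspec := IsLocalization.mk'_spec Y.functionField a s
  rw [hst] at hspec
  -- apply `e` : `e t' = f.stalkMap ξ t = germ (c ^ p ^ n)`
  have het : e t' = X.germToFunctionField (f ⁻¹ᵁ V) c ^ p ^ n := by
    rw [ht', he', hk]
  have := congrArg e hspec
  rw [map_mul, het] at this
  change _ * e (Y.germToFunctionField V (s : Γ(Y, V))) = e (Y.germToFunctionField V a) at this
  rw [he, he] at this
  apply X.germToFunctionField_injective (f ⁻¹ᵁ V)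
  rw [map_mul, map_pow, mul_comm]
  exact this

/-- **The Frobenius power of a finite radicial cover of a normal integral scheme factors
through the base.** Let `f : X → Y` be a finite, universally injective, dominant morphism of
integral schemes with `Y` normal, `p` a prime with `p = 0` on `Y`, and `V ⊆ Y` an affine open.
Then for some `N` there is a ring homomorphism `σ : Γ(X, f⁻¹V) → Γ(Y, V)` with
`f^*(σ c) = c^{p^N}` and `σ(f^* a) = a^{p^N}`. [folklore] -/
theorem exists_frobeniusFactor_app [IsDominant f] [UniversallyInjective f] [IsFinite f]
    (hY : ∀ y : Y, IsIntegrallyClosed (Y.presheaf.stalk y))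
    (p : ℕ) [Fact p.Prime] (hp : (p : Γ(Y, ⊤)) = 0) (V : Y.Opens) (hV : IsAffineOpen V)
    [Nonempty (f ⁻¹ᵁ V)] [Nonempty V] :
    ∃ (N : ℕ) (σ : Γ(X, f ⁻¹ᵁ V) →+* Γ(Y, V)),
      (∀ c, f.app V (σ c) = c ^ p ^ N) ∧ ∀ a, σ (f.app V a) = a ^ p ^ N := by
  haveI : IsSchemeTheoreticallyDominant f := .of_isDominant f
  haveI : Nonempty ((⟨V, hV⟩ : Y.affineOpens) : Y.Opens) := ‹Nonempty V›
  haveI : IsIntegrallyClosed Γ(Y, V) := isIntegrallyClosed_sections_of_stalk hY ⟨V, hV⟩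
  have hpX : (p : Γ(X, f ⁻¹ᵁ V)) = 0 := by
    rw [← map_natCast (f.app V).hom p,
      ← map_natCast (Y.presheaf.map (homOfLE (le_top : V ≤ ⊤)).op).hom p, hp, map_zero, map_zero]
  haveI : CharP Γ(X, f ⁻¹ᵁ V) p := (CharP.charP_iff_prime_eq_zero Fact.out).mpr hpX
  exact exists_frobeniusFactor (f.app V).hom (f.app_injective V) (f.finite_app V hV) p
    (exists_mul_pow_eq_of_universallyInjective f p hp V hV)

end Summit.ResolutionOfSingularities.ResolutionOfSingularities.Theorems

end
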